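import Mathlib
import HarnessLib
import Summits.HubbardSuperconductivity.HubbardSuperconductivity.Theorems.KLProgrammeH10TwoPointLimitSectorMultiplierJump
import Summits.HubbardSuperconductivity.HubbardSuperconductivity.Theorems.KLProgrammeKLRegimeEngineScaleWtSliceRows

/-!
# Route `KLProgramme` — engine support, route (L2): the WEIGHTED position sums of ONE overlap kernel `(E′S)((y,ℓ′),(x,ℓ))` (tree weight
# `klScaleWt L M β n` on the pair of leg positions) are `(βL²)⁻¹ ×` WEIGHTED `ℓ¹` norms of its character sum; weighted overlap-count reductions

Cell `gate-hubbard-kl`, seat p3 (g10); program «W2 = weighted overlap rows» (KL STATUS 2026-08-27 19:05Z), file W2e (part 1): the position-moment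
twin of p4's `…OverlapKernelCharSum` and `…FrameSectorOverlap` §1.  With the moment weight at scale `n`,
`w_n(z) = 1 + (Λ_nβ/(2M))|z̃₁| + Λ_n|z̃₂⁰| + Λ_n|z̃₂¹|` (even; dominates the pair tree weight — p3 g9's `klScaleWt_pair_latticeLegPos_le`, here with
two sector types, `klScaleWt_pair_latticeLegPos_le'`):

* `rowSum_wt_sectorAnalysis_mul_sectorSub_le`, `colSum_wt_sectorAnalysis_mul_sectorSub_le` — p4's overlap-count reductions with a weight `W ≥ 0`;
* **`rowSumWt_overlapKernel_le`**, **`colSumWt_overlapKernel_le`** — per `(ω′, ω, σ, c)` and fixed row (column) point: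
  `Σ_x ‖(E′S)((y,ℓ′),(x,ℓ))‖·wt_n{pos(y,ℓ′), pos(x,ℓ)} ≤ (βL²)⁻¹·Σ_z w_n(z)‖S_{ω′ω}(z)‖`.

Everything is proved; no definitions; nothing about the model is asserted. [cite: BenfattoGiulianiMastropietro2006, §2.7 (2.71)–(2.71a)]
-/

noncomputable section

namespace Summit.HubbardSuperconductivity.HubbardSuperconductivity.Theorems.TorusFourierL2

set_option linter.dupNamespace false -- summit = problem name (single-conjunct summit), D-0017

open Finset Complex Literature.MathematicalPhysics.QuantumLattice Literature.Probability.LatticeModels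
open Summit.HubbardSuperconductivity.HubbardSuperconductivity.Theorems.KLProgrammeLegKernels
open Summit.HubbardSuperconductivity.HubbardSuperconductivity.Theorems.KLRegimeSplit
open Summit.HubbardSuperconductivity.HubbardSuperconductivity.Theorems.EngineV8
open Summit.HubbardSuperconductivity.HubbardSuperconductivity.Theorems.PerturbedFermiCurve
open scoped Real ComplexConjugate

open Classical

variable {L M : ℕ} [NeZero L] [NeZero M] {N N' : ℕ}

/-! ### §1 The overlap-count reductions with a weight -/

omit [NeZero M] in
/-- **Weighted row sum ≤ overlap count × one-kernel weighted size** (any weight `W ≥ 0`). [cite: BenfattoGiulianiMastropietro2006, §2.7 (2.71a)] -/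
theorem rowSum_wt_sectorAnalysis_mul_sectorSub_le (β : ℝ) (F' : Fin N' → FreqMomentum L M → ℂ)
    (F : Fin N → FreqMomentum L M → ℂ) {novl : ℕ}
    (hovl : ∀ ω' : Fin N', ((Finset.univ : Finset (Fin N)).filter
      (fun ω => ∃ k, F' ω' k ≠ 0 ∧ F ω k ≠ 0)).card ≤ novl)
    (W : SpaceTimeIdx L M × SectorLeg N' → SpaceTimeIdx L M × SectorLeg N → ℝ)
    {B : ℝ} (hB0 : 0 ≤ B)
    (hB : ∀ (ω' : Fin N') (ω : Fin N) (σ c : Fin 2) (y : SpaceTimeIdx L M),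
      ∑ x : SpaceTimeIdx L M, ‖(sectorAnalysisMatrix L M β F' * sectorSubMatrix L M β F) (y, ((ω', σ), c)) (x, ((ω, σ), c))‖ *
        W (y, ((ω', σ), c)) (x, ((ω, σ), c)) ≤ B)
    (Y' : SpaceTimeIdx L M × SectorLeg N') :
    ∑ Y, ‖(sectorAnalysisMatrix L M β F' * sectorSubMatrix L M β F) Y' Y‖ * W Y' Y ≤ novl * B := by
  obtain ⟨y, ⟨ω', σ'⟩, c'⟩ := Y'
  rw [sum_spaceTime_sectorLeg_eq]
  have hvan : ∀ (ω : Fin N) (σ c : Fin 2) (x : SpaceTimeIdx L M), ¬ (σ = σ' ∧ c = c') →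
      ‖(sectorAnalysisMatrix L M β F' * sectorSubMatrix L M β F) (y, ((ω', σ'), c')) (x, ((ω, σ), c))‖ *
        W (y, ((ω', σ'), c')) (x, ((ω, σ), c)) = 0 := by
    intro ω σ c x hne
    rw [sectorAnalysis_mul_sectorSub_apply, if_neg (by simpa using hne), norm_zero, zero_mul]
  have hω : ∀ ω : Fin N, ∑ σ : Fin 2, ∑ c : Fin 2, ∑ x : SpaceTimeIdx L M,
      ‖(sectorAnalysisMatrix L M β F' * sectorSubMatrix L M β F) (y, ((ω', σ'), c')) (x, ((ω, σ), c))‖ *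
        W (y, ((ω', σ'), c')) (x, ((ω, σ), c)) =
      ∑ x : SpaceTimeIdx L M, ‖(sectorAnalysisMatrix L M β F' * sectorSubMatrix L M β F) (y, ((ω', σ'), c')) (x, ((ω, σ'), c'))‖ *
        W (y, ((ω', σ'), c')) (x, ((ω, σ'), c')) := by
    intro ω
    rw [Finset.sum_eq_single σ', Finset.sum_eq_single c']
    · intro c _ hc; exact Finset.sum_eq_zero fun x _ => hvan ω σ' c x (by simp [hc])
    · simp
    · intro σ _ hσ; exact Finset.sum_eq_zero fun c _ => Finset.sum_eq_zero fun x _ => hvan ω σ c x (by simp [hσ])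
    · simp
  simp_rw [hω]
  set S := (Finset.univ : Finset (Fin N)).filter (fun ω => ∃ k, F' ω' k ≠ 0 ∧ F ω k ≠ 0) with hS
  have hsplit : ∑ ω : Fin N, ∑ x : SpaceTimeIdx L M,
      ‖(sectorAnalysisMatrix L M β F' * sectorSubMatrix L M β F) (y, ((ω', σ'), c')) (x, ((ω, σ'), c'))‖ *
        W (y, ((ω', σ'), c')) (x, ((ω, σ'), c')) =
      ∑ ω ∈ S, ∑ x : SpaceTimeIdx L M,
      ‖(sectorAnalysisMatrix L M β F' * sectorSubMatrix L M β F) (y, ((ω', σ'), c')) (x, ((ω, σ'), c'))‖ *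
        W (y, ((ω', σ'), c')) (x, ((ω, σ'), c')) := by
    symm
    refine Finset.sum_subset (Finset.filter_subset _ _) fun ω _ hω => Finset.sum_eq_zero fun x _ => ?_
    rw [hS, Finset.mem_filter, not_and] at hω
    rw [sectorAnalysis_mul_sectorSub_eq_zero_of_disjoint β F' F _ _ (hω (Finset.mem_univ ω)), norm_zero, zero_mul]
  rw [hsplit]
  calc _ ≤ ∑ ω ∈ S, B := Finset.sum_le_sum fun ω _ => hB ω' ω σ' c' y
    _ = S.card * B := by rw [Finset.sum_const, nsmul_eq_mul]
    _ ≤ novl * B := mul_le_mul_of_nonneg_right (by exact_mod_cast hovl ω') hB0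

omit [NeZero M] in
/-- **Weighted column sum ≤ transposed overlap count × one-kernel weighted size** (any weight `W ≥ 0`).
[cite: BenfattoGiulianiMastropietro2006, §2.7 (2.71a)] -/
theorem colSum_wt_sectorAnalysis_mul_sectorSub_le (β : ℝ) (F' : Fin N' → FreqMomentum L M → ℂ)
    (F : Fin N → FreqMomentum L M → ℂ) {novl' : ℕ}
    (hovl : ∀ ω : Fin N, ((Finset.univ : Finset (Fin N')).filter
      (fun ω' => ∃ k, F' ω' k ≠ 0 ∧ F ω k ≠ 0)).card ≤ novl')
    (W : SpaceTimeIdx L M × SectorLeg N' → SpaceTimeIdx L M × SectorLeg N → ℝ)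
    {B' : ℝ} (hB0 : 0 ≤ B')
    (hB : ∀ (ω' : Fin N') (ω : Fin N) (σ c : Fin 2) (x : SpaceTimeIdx L M),
      ∑ y : SpaceTimeIdx L M, ‖(sectorAnalysisMatrix L M β F' * sectorSubMatrix L M β F) (y, ((ω', σ), c)) (x, ((ω, σ), c))‖ *
        W (y, ((ω', σ), c)) (x, ((ω, σ), c)) ≤ B')
    (Y : SpaceTimeIdx L M × SectorLeg N) :
    ∑ Y', ‖(sectorAnalysisMatrix L M β F' * sectorSubMatrix L M β F) Y' Y‖ * W Y' Y ≤ novl' * B' := by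
  obtain ⟨x, ⟨ω, σ⟩, c⟩ := Y
  rw [sum_spaceTime_sectorLeg_eq]
  have hvan : ∀ (ω' : Fin N') (σ' c' : Fin 2) (y : SpaceTimeIdx L M), ¬ (σ' = σ ∧ c' = c) →
      ‖(sectorAnalysisMatrix L M β F' * sectorSubMatrix L M β F) (y, ((ω', σ'), c')) (x, ((ω, σ), c))‖ *
        W (y, ((ω', σ'), c')) (x, ((ω, σ), c)) = 0 := by
    intro ω' σ' c' y hne
    rw [sectorAnalysis_mul_sectorSub_apply, if_neg (by
      rintro ⟨h1, h2⟩; exact hne ⟨h1.symm, h2.symm⟩), norm_zero, zero_mul]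
  have hω : ∀ ω' : Fin N', ∑ σ' : Fin 2, ∑ c' : Fin 2, ∑ y : SpaceTimeIdx L M,
      ‖(sectorAnalysisMatrix L M β F' * sectorSubMatrix L M β F) (y, ((ω', σ'), c')) (x, ((ω, σ), c))‖ *
        W (y, ((ω', σ'), c')) (x, ((ω, σ), c)) =
      ∑ y : SpaceTimeIdx L M, ‖(sectorAnalysisMatrix L M β F' * sectorSubMatrix L M β F) (y, ((ω', σ), c)) (x, ((ω, σ), c))‖ *
        W (y, ((ω', σ), c)) (x, ((ω, σ), c)) := by
    intro ω'
    rw [Finset.sum_eq_single σ, Finset.sum_eq_single c]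
    · intro c' _ hc; exact Finset.sum_eq_zero fun y _ => hvan ω' σ c' y (by simp [hc])
    · simp
    · intro σ' _ hσ; exact Finset.sum_eq_zero fun c' _ => Finset.sum_eq_zero fun y _ => hvan ω' σ' c' y (by simp [hσ])
    · simp
  simp_rw [hω]
  set S := (Finset.univ : Finset (Fin N')).filter (fun ω' => ∃ k, F' ω' k ≠ 0 ∧ F ω k ≠ 0) with hS
  have hsplit : ∑ ω' : Fin N', ∑ y : SpaceTimeIdx L M,
      ‖(sectorAnalysisMatrix L M β F' * sectorSubMatrix L M β F) (y, ((ω', σ), c)) (x, ((ω, σ), c))‖ *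
        W (y, ((ω', σ), c)) (x, ((ω, σ), c)) =
      ∑ ω' ∈ S, ∑ y : SpaceTimeIdx L M,
      ‖(sectorAnalysisMatrix L M β F' * sectorSubMatrix L M β F) (y, ((ω', σ), c)) (x, ((ω, σ), c))‖ *
        W (y, ((ω', σ), c)) (x, ((ω, σ), c)) := by
    symm
    refine Finset.sum_subset (Finset.filter_subset _ _) fun ω' _ hω' => Finset.sum_eq_zero fun y _ => ?_
    rw [hS, Finset.mem_filter, not_and] at hω'
    rw [sectorAnalysis_mul_sectorSub_eq_zero_of_disjoint β F' F _ _ (hω' (Finset.mem_univ ω')), norm_zero, zero_mul]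
  rw [hsplit]
  calc _ ≤ ∑ ω' ∈ S, B' := Finset.sum_le_sum fun ω' _ => hB ω' ω σ c x
    _ = S.card * B' := by rw [Finset.sum_const, nsmul_eq_mul]
    _ ≤ novl' * B' := mul_le_mul_of_nonneg_right (by exact_mod_cast hovl ω) hB0

/-! ### §2 The weighted position sums of one kernel are weighted `ℓ¹` norms of its character sum -/

/-- `|(−a)~| = |ã|` on `ℤ/n` (real form). -/
theorem abs_valMinAbs_neg_real {n : ℕ} [NeZero n] (a : ZMod n) : |(((-a).valMinAbs : ℤ) : ℝ)| = |((a.valMinAbs : ℤ) : ℝ)| := by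
  have h := ZMod.natAbs_valMinAbs_neg a
  have h' : (((-a).valMinAbs.natAbs : ℕ) : ℝ) = ((a.valMinAbs.natAbs : ℕ) : ℝ) := by exact_mod_cast h
  simpa only [Nat.cast_natAbs, Int.cast_abs] using h'

/-- **The moment weight at scale `n` is even.** -/
theorem scaleMomentWt_neg (β : ℝ) (n : ℕ) (z : TorusSite 1 (2 * M) × TorusSite 2 L) :
    1 + klScale klE0 n * β / (2 * M) * |((((-z).1 0).valMinAbs : ℤ) : ℝ)| + klScale klE0 n * |((((-z).2 0).valMinAbs : ℤ) : ℝ)| +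
        klScale klE0 n * |((((-z).2 1).valMinAbs : ℤ) : ℝ)| =
      1 + klScale klE0 n * β / (2 * M) * |(((z.1 0).valMinAbs : ℤ) : ℝ)| + klScale klE0 n * |(((z.2 0).valMinAbs : ℤ) : ℝ)| +
        klScale klE0 n * |(((z.2 1).valMinAbs : ℤ) : ℝ)| := by
  simp only [Prod.fst_neg, Prod.snd_neg, Pi.neg_apply, abs_valMinAbs_neg_real]

/-- **The scale-`n` tree weight on a pair of lattice legs (possibly of different sector types) is below the moment weight**:
`klScaleWt L M β n {pos X, pos Y} ≤ 1 + (Λ_nβ/(2M))·|(x₀ − y₀)~| + Λ_n|(x⃗ − y⃗)~₁| + Λ_n|(x⃗ − y⃗)~₂|` (`0 ≤ β`) — p3 g9's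
`EngineV8.klScaleWt_pair_latticeLegPos_le` with the two legs in `SectorLeg N′` and `SectorLeg N`. -/
theorem klScaleWt_pair_latticeLegPos_le' {β : ℝ} (hβ : 0 ≤ β) (n : ℕ) (X : SpaceTimeIdx L M × SectorLeg N') (Y : SpaceTimeIdx L M × SectorLeg N) :
    klScaleWt L M β n {latticeLegPos (2 * (2 * M)) X, latticeLegPos (2 * (2 * M)) Y} ≤
      1 + klScale klE0 n * β / (2 * M) * |(((((X.1.1 : ℕ) : ZMod (2 * M)) - ((Y.1.1 : ℕ) : ZMod (2 * M))).valMinAbs : ℤ) : ℝ)| +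
        klScale klE0 n * |((((X.1.2 - Y.1.2) 0).valMinAbs : ℤ) : ℝ)| + klScale klE0 n * |((((X.1.2 - Y.1.2) 1).valMinAbs : ℤ) : ℝ)| := by
  -- the position of `Y` is the position of the leg `(Y.1, X.2)` of the type of `X`
  have hpos : latticeLegPos (2 * (2 * M)) Y = latticeLegPos (2 * (2 * M)) ((Y.1, X.2) : SpaceTimeIdx L M × SectorLeg N') := by
    rw [latticeLegPos_apply, latticeLegPos_apply]
  rw [hpos]
  exact klScaleWt_pair_latticeLegPos_le hβ n X ((Y.1, X.2) : SpaceTimeIdx L M × SectorLeg N')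

/-- **Weighted row position sum of one kernel**: for every `ω′, ω, σ, c` and every row point `y`, with the tree weight `klScaleWt L M β n` on the pair
of leg positions: `Σ_x ‖(E′S)((y,ℓ′),(x,ℓ))‖·wt{pos(y,ℓ′), pos(x,ℓ)} ≤ (βL²)⁻¹·Σ_z w_n(z)‖S_{ω′ω}(z)‖` (`β > 0`).
[cite: BenfattoGiulianiMastropietro2006, §2.7 (2.71a)] -/
theorem rowSumWt_overlapKernel_le {β : ℝ} (hβ : 0 < β) (F' : Fin N' → FreqMomentum L M → ℂ) (F : Fin N → FreqMomentum L M → ℂ)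
    (n : ℕ) (ω' : Fin N') (ω : Fin N) (σ c : Fin 2) (y : SpaceTimeIdx L M) :
    ∑ x : SpaceTimeIdx L M, ‖(sectorAnalysisMatrix L M β F' * sectorSubMatrix L M β F) (y, ((ω', σ), c)) (x, ((ω, σ), c))‖ *
        klScaleWt L M β n {latticeLegPos (2 * (2 * M)) ((y, ((ω', σ), c)) : SpaceTimeIdx L M × SectorLeg N'),
          latticeLegPos (2 * (2 * M)) ((x, ((ω, σ), c)) : SpaceTimeIdx L M × SectorLeg N)} ≤
      1 / (β * (L : ℝ) ^ 2) * ∑ z : TorusSite 1 (2 * M) × TorusSite 2 L,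
        (1 + klScale klE0 n * β / (2 * M) * |(((z.1 0).valMinAbs : ℤ) : ℝ)| + klScale klE0 n * |(((z.2 0).valMinAbs : ℤ) : ℝ)| +
            klScale klE0 n * |(((z.2 1).valMinAbs : ℤ) : ℝ)|) *
          ‖∑ q : TorusSite 1 (2 * M) × TorusSite 2 L, (torusChar q.1 z.1 * torusChar q.2 z.2) •
            (F' ω' (⟨(q.1 0).val, ZMod.val_lt (q.1 0)⟩, q.2) * F ω (⟨(q.1 0).val, ZMod.val_lt (q.1 0)⟩, q.2))‖ := by
  have hL : (0 : ℝ) < L := Nat.cast_pos.2 (Nat.pos_of_ne_zero (NeZero.ne L))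
  have hc0 : 0 ≤ 1 / (β * (L : ℝ) ^ 2) := by positivity
  -- the summand as a function of the displacement
  set h : TorusSite 1 (2 * M) × TorusSite 2 L → ℝ := fun z =>
    (1 + klScale klE0 n * β / (2 * M) * |(((z.1 0).valMinAbs : ℤ) : ℝ)| + klScale klE0 n * |(((z.2 0).valMinAbs : ℤ) : ℝ)| +
        klScale klE0 n * |(((z.2 1).valMinAbs : ℤ) : ℝ)|) *
      ‖∑ q : TorusSite 1 (2 * M) × TorusSite 2 L, (torusChar q.1 z.1 * torusChar q.2 z.2) •
        (F' ω' (⟨(q.1 0).val, ZMod.val_lt (q.1 0)⟩, q.2) * F ω (⟨(q.1 0).val, ZMod.val_lt (q.1 0)⟩, q.2))‖ with hh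
  -- the displacement `y − x` on the torus
  have hpt : ∀ x : SpaceTimeIdx L M,
      ‖(sectorAnalysisMatrix L M β F' * sectorSubMatrix L M β F) (y, ((ω', σ), c)) (x, ((ω, σ), c))‖ *
        klScaleWt L M β n {latticeLegPos (2 * (2 * M)) ((y, ((ω', σ), c)) : SpaceTimeIdx L M × SectorLeg N'),
          latticeLegPos (2 * (2 * M)) ((x, ((ω, σ), c)) : SpaceTimeIdx L M × SectorLeg N)} ≤
        1 / (β * (L : ℝ) ^ 2) *
          h ((fun _ : Fin 1 => (((if c = 0 then x else y).1 : ℕ) : ZMod (2 * M)) - (((if c = 0 then y else x).1 : ℕ) : ZMod (2 * M))),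
            (if c = 0 then x else y).2 - (if c = 0 then y else x).2) := by
    intro x
    rw [norm_overlapKernel_eq_charSum hβ, hh]
    dsimp only
    rw [mul_assoc]
    refine mul_le_mul_of_nonneg_left ?_ hc0
    rw [mul_comm]
    refine mul_le_mul_of_nonneg_right ?_ (norm_nonneg _)
    have hw := klScaleWt_pair_latticeLegPos_le' (L := L) (M := M) hβ.le n ((y, ((ω', σ), c)) : SpaceTimeIdx L M × SectorLeg N')
      ((x, ((ω, σ), c)) : SpaceTimeIdx L M × SectorLeg N)
    refine hw.trans (le_of_eq ?_)
    fin_cases c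
    · -- `c = 0`: the displacement is `x − y = −(y − x)`
      simp only [Fin.zero_eta, Fin.isValue, if_true]
      have e1 : (((x.1 : ℕ) : ZMod (2 * M)) - ((y.1 : ℕ) : ZMod (2 * M))) = -(((y.1 : ℕ) : ZMod (2 * M)) - ((x.1 : ℕ) : ZMod (2 * M))) := by
        ring
      have e2 : ∀ j, (x.2 - y.2) j = -((y.2 - x.2) j) := fun j => by simp
      rw [e1, e2 0, e2 1, abs_valMinAbs_neg_real, abs_valMinAbs_neg_real, abs_valMinAbs_neg_real]
    · simp only [Fin.mk_one, Fin.isValue, show (1 : Fin 2) ≠ 0 by decide, if_false]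
  refine (sum_le_sum fun x _ => hpt x).trans ?_
  rw [← mul_sum]
  refine mul_le_mul_of_nonneg_left (le_of_eq ?_) hc0
  fin_cases c
  · simp only [Fin.zero_eta, Fin.isValue, if_true]
    exact sum_spaceTime_eq_sum_prodTorus_fst h y
  · simp only [Fin.mk_one, Fin.isValue, show (1 : Fin 2) ≠ 0 by decide, if_false]
    exact sum_spaceTime_eq_sum_prodTorus h y

/-- **Weighted column position sum of one kernel** (sum over the row point `y` at fixed column point `x`): the same bound.
[cite: BenfattoGiulianiMastropietro2006, §2.7 (2.71a)] -/
theorem colSumWt_overlapKernel_le {β : ℝ} (hβ : 0 < β) (F' : Fin N' → FreqMomentum L M → ℂ) (F : Fin N → FreqMomentum L M → ℂ)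
    (n : ℕ) (ω' : Fin N') (ω : Fin N) (σ c : Fin 2) (x : SpaceTimeIdx L M) :
    ∑ y : SpaceTimeIdx L M, ‖(sectorAnalysisMatrix L M β F' * sectorSubMatrix L M β F) (y, ((ω', σ), c)) (x, ((ω, σ), c))‖ *
        klScaleWt L M β n {latticeLegPos (2 * (2 * M)) ((y, ((ω', σ), c)) : SpaceTimeIdx L M × SectorLeg N'),
          latticeLegPos (2 * (2 * M)) ((x, ((ω, σ), c)) : SpaceTimeIdx L M × SectorLeg N)} ≤
      1 / (β * (L : ℝ) ^ 2) * ∑ z : TorusSite 1 (2 * M) × TorusSite 2 L,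
        (1 + klScale klE0 n * β / (2 * M) * |(((z.1 0).valMinAbs : ℤ) : ℝ)| + klScale klE0 n * |(((z.2 0).valMinAbs : ℤ) : ℝ)| +
            klScale klE0 n * |(((z.2 1).valMinAbs : ℤ) : ℝ)|) *
          ‖∑ q : TorusSite 1 (2 * M) × TorusSite 2 L, (torusChar q.1 z.1 * torusChar q.2 z.2) •
            (F' ω' (⟨(q.1 0).val, ZMod.val_lt (q.1 0)⟩, q.2) * F ω (⟨(q.1 0).val, ZMod.val_lt (q.1 0)⟩, q.2))‖ := by
  have hL : (0 : ℝ) < L := Nat.cast_pos.2 (Nat.pos_of_ne_zero (NeZero.ne L))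
  have hc0 : 0 ≤ 1 / (β * (L : ℝ) ^ 2) := by positivity
  set h : TorusSite 1 (2 * M) × TorusSite 2 L → ℝ := fun z =>
    (1 + klScale klE0 n * β / (2 * M) * |(((z.1 0).valMinAbs : ℤ) : ℝ)| + klScale klE0 n * |(((z.2 0).valMinAbs : ℤ) : ℝ)| +
        klScale klE0 n * |(((z.2 1).valMinAbs : ℤ) : ℝ)|) *
      ‖∑ q : TorusSite 1 (2 * M) × TorusSite 2 L, (torusChar q.1 z.1 * torusChar q.2 z.2) •
        (F' ω' (⟨(q.1 0).val, ZMod.val_lt (q.1 0)⟩, q.2) * F ω (⟨(q.1 0).val, ZMod.val_lt (q.1 0)⟩, q.2))‖ with hh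
  have hpt : ∀ y : SpaceTimeIdx L M,
      ‖(sectorAnalysisMatrix L M β F' * sectorSubMatrix L M β F) (y, ((ω', σ), c)) (x, ((ω, σ), c))‖ *
        klScaleWt L M β n {latticeLegPos (2 * (2 * M)) ((y, ((ω', σ), c)) : SpaceTimeIdx L M × SectorLeg N'),
          latticeLegPos (2 * (2 * M)) ((x, ((ω, σ), c)) : SpaceTimeIdx L M × SectorLeg N)} ≤
        1 / (β * (L : ℝ) ^ 2) *
          h ((fun _ : Fin 1 => (((if c = 0 then x else y).1 : ℕ) : ZMod (2 * M)) - (((if c = 0 then y else x).1 : ℕ) : ZMod (2 * M))),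
            (if c = 0 then x else y).2 - (if c = 0 then y else x).2) := by
    intro y
    rw [norm_overlapKernel_eq_charSum hβ, hh]
    dsimp only
    rw [mul_assoc]
    refine mul_le_mul_of_nonneg_left ?_ hc0
    rw [mul_comm]
    refine mul_le_mul_of_nonneg_right ?_ (norm_nonneg _)
    have hw := klScaleWt_pair_latticeLegPos_le' (L := L) (M := M) hβ.le n ((y, ((ω', σ), c)) : SpaceTimeIdx L M × SectorLeg N')
      ((x, ((ω, σ), c)) : SpaceTimeIdx L M × SectorLeg N)
    refine hw.trans (le_of_eq ?_)
    fin_cases c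
    · simp only [Fin.zero_eta, Fin.isValue, if_true]
      have e1 : (((x.1 : ℕ) : ZMod (2 * M)) - ((y.1 : ℕ) : ZMod (2 * M))) = -(((y.1 : ℕ) : ZMod (2 * M)) - ((x.1 : ℕ) : ZMod (2 * M))) := by
        ring
      have e2 : ∀ j, (x.2 - y.2) j = -((y.2 - x.2) j) := fun j => by simp
      rw [e1, e2 0, e2 1, abs_valMinAbs_neg_real, abs_valMinAbs_neg_real, abs_valMinAbs_neg_real]
    · simp only [Fin.mk_one, Fin.isValue, show (1 : Fin 2) ≠ 0 by decide, if_false]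
  refine (sum_le_sum fun y _ => hpt y).trans ?_
  rw [← mul_sum]
  refine mul_le_mul_of_nonneg_left (le_of_eq ?_) hc0
  fin_cases c
  · simp only [Fin.zero_eta, Fin.isValue, if_true]
    exact sum_spaceTime_eq_sum_prodTorus h x
  · simp only [Fin.mk_one, Fin.isValue, show (1 : Fin 2) ≠ 0 by decide, if_false]
    exact sum_spaceTime_eq_sum_prodTorus_fst h x

end Summit.HubbardSuperconductivity.HubbardSuperconductivity.Theorems.TorusFourierL2

end
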